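import Mathlib

/-!
# `DivisionGap.PerMultiplesHard` (stmt-ValiantsHypothesis-5068), line `uncharged-face-walk`:
the supply–demand theorem with forbidden cells (stub `stub_transportation`)

For a cell set `G ⊆ [n]²` and margins `r, c : Fin n → ℕ` with `Σ r = Σ c`: if every row set `X`
satisfies `r(X) ≤ c(N_G(X))`, where `N_G(X)` is the set of columns `j` with `(i, j) ∈ G` for some
`i ∈ X`, then some table `M : [n]² → ℕ` supported inside `G` has row sums `r` and column sums `c`
(Gale 1957, the "if" direction).

Mechanism: Hall's marriage theorem (`Fintype.all_card_le_filter_rel_iff_exists_injective`) on the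
BLOW-UP.  Row `i` is replaced by `r i` copies (the type `Σ i, Fin (r i)`), column `j` by `c j`
copies, and a copy of row `i` may be matched to any copy of any column `j` with `(i, j) ∈ G`.
Hall's condition for a set `A` of row copies with row set `X` reads
`#A ≤ r(X) ≤ c(N_G(X)) = #(column copies over N_G(X))`.  The resulting injection of row copies
into column copies is a bijection (`Σ r = Σ c`), and `M (i, j) :=` the number of copies of `i`
sent to copies of `j` has the required margins and lives on `G`.
-/

noncomputable section

set_option linter.dupNamespace false

namespace Summit.ValiantsHypothesis.ValiantsHypothesis.Theorems.DivisionGap.PerMultiplesHard.Transportation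

open scoped BigOperators

open Finset

/-- The copies over a set `X` of indices number `∑ i ∈ X, r i`. [folklore] -/
theorem card_sigma_univ {n : ℕ} (r : Fin n → ℕ) (X : Finset (Fin n)) :
    #(X.sigma fun k => (univ : Finset (Fin (r k)))) = ∑ i ∈ X, r i := by
  rw [card_sigma]
  simp

/-- Over a fixed index `i` the blow-up `Σ k, Fin (r k)` has exactly `r i` elements. [folklore] -/
theorem card_copies_fiber {n : ℕ} (r : Fin n → ℕ) (i : Fin n) :
    #(univ.filter fun x : (Σ k : Fin n, Fin (r k)) => x.1 = i) = r i := by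
  have h : (univ.filter fun x : (Σ k : Fin n, Fin (r k)) => x.1 = i)
      = ({i} : Finset (Fin n)).sigma fun k => (univ : Finset (Fin (r k))) := by
    ext x
    simp
  rw [h, card_sigma_univ, sum_singleton]

/-- **The supply–demand theorem with forbidden cells** (Gale 1957; "if" direction).
For `G ⊆ [n]²` and margins `r, c : Fin n → ℕ` with `Σ r = Σ c`: if every row set `X` satisfies
`r(X) ≤ c(N_G(X))` (`N_G(X)` = the columns seeing `X` through `G`), then some table
`M : [n]² →₀ ℕ` supported inside `G` has row sums `r` and column sums `c`.  Proof: Hall's theorem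
on the blow-up (row copies `Σ i, Fin (r i)`, column copies `Σ j, Fin (c j)`; a copy of `i` may go
to any copy of any `j` with `(i, j) ∈ G`); the matching is a bijection since `Σ r = Σ c`, and
`M (i, j)` counts the copies of `i` sent to copies of `j`. [folklore] -/
theorem stub_transportation :
    ∀ (n : ℕ) (G : Finset (Fin n × Fin n)) (r c : Fin n → ℕ), ∑ i, r i = ∑ j, c j →
      (∀ X : Finset (Fin n),
        ∑ i ∈ X, r i ≤ ∑ j ∈ Finset.univ.filter (fun j : Fin n => ∃ i ∈ X, (i, j) ∈ G), c j) →
      ∃ M : (Fin n × Fin n) →₀ ℕ, M.support ⊆ G ∧ (∀ i, ∑ j, M (i, j) = r i) ∧ (∀ j, ∑ i, M (i, j) = c j) := by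
  intro n G r c hsum hHall
  /- Step 1: Hall's theorem on the blow-up gives an injection `F` of row copies into column copies
  along the cells of `G`. -/
  obtain ⟨F, hFinj, hFrel⟩ : ∃ F : (Σ k : Fin n, Fin (r k)) → (Σ k : Fin n, Fin (c k)),
      Function.Injective F ∧ ∀ x, (x.1, (F x).1) ∈ G := by
    refine (Fintype.all_card_le_filter_rel_iff_exists_injective
      fun (x : Σ k : Fin n, Fin (r k)) (y : Σ k : Fin n, Fin (c k)) => (x.1, y.1) ∈ G).1
      fun A => ?_
    calc #A ≤ #((A.image Sigma.fst).sigma fun k => (univ : Finset (Fin (r k)))) := by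
          refine card_le_card fun x hx => ?_
          rw [mem_sigma]
          exact ⟨mem_image_of_mem Sigma.fst hx, mem_univ _⟩
      _ = ∑ i ∈ A.image Sigma.fst, r i := card_sigma_univ r _
      _ ≤ _ := hHall (A.image Sigma.fst)
      _ = #((univ.filter fun j : Fin n => ∃ i ∈ A.image Sigma.fst, (i, j) ∈ G).sigma
            fun k => (univ : Finset (Fin (c k)))) := (card_sigma_univ c _).symm
      _ ≤ _ := by
          refine card_le_card fun y hy => ?_
          rw [mem_sigma, mem_filter] at hy
          obtain ⟨⟨-, i, hiX, hiG⟩, -⟩ := hy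
          rw [mem_image] at hiX
          obtain ⟨a, haA, rfl⟩ := hiX
          rw [mem_filter]
          exact ⟨mem_univ _, a, haA, hiG⟩
  /- Step 2: `F` is a bijection, both blow-ups having `∑ r = ∑ c` elements. -/
  have hFbij : Function.Bijective F := by
    rw [Fintype.bijective_iff_injective_and_card]
    refine ⟨hFinj, ?_⟩
    simpa using hsum
  /- Step 3: the table entry at `(i, j)` counts the copies of row `i` sent to copies of column `j`;
  `T i j` is the set of these copies. -/
  set T : Fin n → Fin n → Finset (Σ k : Fin n, Fin (r k)) :=
    fun i j => univ.filter fun x => x.1 = i ∧ (F x).1 = j with hT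
  refine ⟨Finsupp.equivFunOnFinite.symm fun e => #(T e.1 e.2), ?_, ?_, ?_⟩
  · -- the support lies inside `G`
    rintro ⟨i, j⟩ he
    rw [Finsupp.mem_support_iff, Finsupp.coe_equivFunOnFinite_symm] at he
    obtain ⟨x, hx⟩ := card_ne_zero.1 he
    simp only [hT, mem_filter, mem_univ, true_and] at hx
    have hG := hFrel x
    rw [hx.1, hx.2] at hG
    exact hG
  · -- row sums
    intro i
    simp only [Finsupp.coe_equivFunOnFinite_symm]
    calc ∑ j, #(T i j)
        = ∑ j, #((univ.filter fun x : (Σ k : Fin n, Fin (r k)) => x.1 = i).filter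
            fun x => (F x).1 = j) := by
          simp only [hT, filter_filter]
      _ = #(univ.filter fun x : (Σ k : Fin n, Fin (r k)) => x.1 = i) :=
          (card_eq_sum_card_fiberwise fun _ _ => mem_coe.2 (mem_univ _)).symm
      _ = r i := card_copies_fiber r i
  · -- column sums
    intro j
    simp only [Finsupp.coe_equivFunOnFinite_symm]
    calc ∑ i, #(T i j)
        = ∑ i, #((univ.filter fun x : (Σ k : Fin n, Fin (r k)) => (F x).1 = j).filter
            fun x => x.1 = i) := by
          refine sum_congr rfl fun i _ => ?_
          rw [hT, filter_filter]
          exact congr_arg _ (filter_congr fun x _ => and_comm)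
      _ = #(univ.filter fun x : (Σ k : Fin n, Fin (r k)) => (F x).1 = j) :=
          (card_eq_sum_card_fiberwise fun _ _ => mem_coe.2 (mem_univ _)).symm
      _ = #((univ.filter fun x : (Σ k : Fin n, Fin (r k)) => (F x).1 = j).map ⟨F, hFinj⟩) :=
          (card_map _).symm
      _ = #(univ.filter fun y : (Σ k : Fin n, Fin (c k)) => y.1 = j) := by
          congr 1
          ext y
          simp only [mem_map, mem_filter, mem_univ, true_and, Function.Embedding.coeFn_mk]
          constructor
          · rintro ⟨x, hx, rfl⟩
            exact hx
          · intro hy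
            obtain ⟨x, rfl⟩ := hFbij.2 y
            exact ⟨x, hy, rfl⟩
      _ = c j := card_copies_fiber c j

end Summit.ValiantsHypothesis.ValiantsHypothesis.Theorems.DivisionGap.PerMultiplesHard.Transportation

end
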